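import Literature.Topology.PlanarFoliations.LoopConjugation
import HarnessLib

/-!
# Every loop of a circle is a power of the injective loop; images of all loops are null together

Topic: Topology / PlanarFoliations (generic circle topology, sequel to `CircleLoops.lean`,
`LoopConjugation.lean`). For a circle `Y` parametrised by an injective loop `β` (continuous,
`1`-periodic, injective on `[0, 1)`, onto):

* `homotopic_of_lifts` (**proved**): two loops at `β 0` whose lifts through `β` (paths of the line
  from `0`) end at the same point are homotopic with fixed ends (interpolate the lifts).
* `loopPow d` (**definition**), `homotopic_loopPow_of_lift` (**proved**): the `d`-fold loop
  `θ ↦ β (d θ)`; a loop whose lift ends at the integer `d` is homotopic to it — **every loop of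
  the circle is homotopic to a power of the injective loop** (`exists_homotopic_loopPow`).
* `loopPow_zero`, `loopPow_neg`, `loopPow_succ_homotopic` (**proved**): `β⁰ = 1`,
  `β^{-d} = (β^d)⁻¹`, `β^{d+1} ≃ β^d · β`.
* `map_loopPow_homotopic_refl`, `map_homotopic_refl_of_map_loop` (**proved**): for
  `Φ : C(Y, Z)`, **if the image loop `Φ ∘ β` is null-homotopic then the image of every loop of
  `Y` at `β 0` is null-homotopic** — used for the horizontals of a fence running in a compact
  leaf whose injective loop has null-homotopic image (the closed orbits of the induced foliation
  of a disc "homotopic to constants in their leaves", Camacho–Lins Neto, Ch. VII §2).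

All statements are [folklore] (covering space theory of the circle, Hatcher Thm. 1.7).
-/

noncomputable section

open Set Filter Function
open _root_.Topology unitInterval

namespace Literature.Topology.PlanarFoliations

namespace CircleLoops

variable {Y : Type*} [TopologicalSpace Y] {Z : Type*} [TopologicalSpace Z] {β : ℝ → Y}

/-! ## Loops with lifts ending at the same point are homotopic -/

/-- **Two loops whose lifts end at the same point are homotopic with fixed ends** (interpolate
the lifts linearly in the line and push down by `β`). [folklore] -/
theorem homotopic_of_lifts (hc : Continuous β) (h₁ h₂ : Path (β 0) (β 0)) (Γ₁ Γ₂ : C(I, ℝ))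
    (h₁0 : Γ₁ 0 = 0) (h₂0 : Γ₂ 0 = 0) (hΓ₁ : ∀ θ, β (Γ₁ θ) = h₁ θ) (hΓ₂ : ∀ θ, β (Γ₂ θ) = h₂ θ)
    (h1 : Γ₁ 1 = Γ₂ 1) : h₁.Homotopic h₂ := by
  refine ⟨{ toFun := fun p ↦ β ((1 - (p.1 : ℝ)) * Γ₁ p.2 + (p.1 : ℝ) * Γ₂ p.2)
            continuous_toFun := ?_
            map_zero_left := fun θ ↦ ?_
            map_one_left := fun θ ↦ ?_
            prop' := fun r θ hθ ↦ ?_ }⟩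
  · refine hc.comp ?_
    have hr : Continuous fun p : I × I ↦ ((p.1 : I) : ℝ) := continuous_subtype_val.comp continuous_fst
    exact ((continuous_const.sub hr).mul (Γ₁.continuous.comp continuous_snd)).add
      (hr.mul (Γ₂.continuous.comp continuous_snd))
  · show β ((1 - (0 : ℝ)) * Γ₁ θ + (0 : ℝ) * Γ₂ θ) = h₁ θ
    rw [sub_zero, one_mul, zero_mul, add_zero, hΓ₁]
  · show β ((1 - (1 : ℝ)) * Γ₁ θ + (1 : ℝ) * Γ₂ θ) = h₂ θ
    rw [sub_self, zero_mul, one_mul, zero_add, hΓ₂]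
  · show β ((1 - (r : ℝ)) * Γ₁ θ + (r : ℝ) * Γ₂ θ) = h₁ θ
    rcases hθ with rfl | rfl
    · rw [h₁0, h₂0, mul_zero, mul_zero, add_zero, ← hΓ₁ 0, h₁0]
    · rw [h1, ← add_mul, sub_add_cancel, one_mul, ← h1, hΓ₁]

/-! ## Powers of the injective loop -/

/-- The `d`-fold loop `θ ↦ β (d θ)`, `d ∈ ℤ`. [folklore] -/
def loopPow (hc : Continuous β) (hp : Periodic β 1) (d : ℤ) : Path (β 0) (β 0) where
  toFun θ := β (d * θ)
  continuous_toFun := hc.comp (continuous_const.mul continuous_subtype_val)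
  source' := by simp
  target' := by
    show β (d * (1 : ℝ)) = β 0
    rw [mul_one]
    exact apply_intCast hp d

/-- The values of `loopPow`. [folklore] -/
@[simp] theorem loopPow_apply (hc : Continuous β) (hp : Periodic β 1) (d : ℤ) (θ : I) :
    loopPow hc hp d θ = β (d * θ) := rfl

/-- **A loop whose lift ends at the integer `d` is homotopic to the `d`-fold loop.** [folklore] -/
theorem homotopic_loopPow_of_lift (hc : Continuous β) (hp : Periodic β 1) (h : Path (β 0) (β 0))
    (Γ : C(I, ℝ)) (hΓ0 : Γ 0 = 0) (hΓ : ∀ θ, β (Γ θ) = h θ) {d : ℤ} (hΓ1 : Γ 1 = d) :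
    h.Homotopic (loopPow hc hp d) := by
  refine homotopic_of_lifts hc h _ Γ ⟨fun θ ↦ d * (θ : ℝ), continuous_const.mul continuous_subtype_val⟩ hΓ0
    (by show (d : ℝ) * ((0 : I) : ℝ) = 0; simp) hΓ (fun θ ↦ rfl) ?_
  show Γ 1 = d * ((1 : I) : ℝ)
  rw [hΓ1]
  simp

/-- **Every loop of the circle is homotopic to a power of the injective loop.** [folklore] -/
theorem exists_homotopic_loopPow [T2Space Y] (hc : Continuous β) (hp : Periodic β 1) (hinj : InjOn β (Ico 0 1))
    (hsurj : range β = univ) (h : Path (β 0) (β 0)) : ∃ d : ℤ, h.Homotopic (loopPow hc hp d) := by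
  obtain ⟨Γ, hΓ0, hΓ, d, hΓ1⟩ := exists_lift_loop hc hp hinj hsurj h
  exact ⟨d, homotopic_loopPow_of_lift hc hp h Γ hΓ0 hΓ hΓ1⟩

/-- `β⁰` is the constant loop. [folklore] -/
theorem loopPow_zero (hc : Continuous β) (hp : Periodic β 1) : loopPow hc hp 0 = Path.refl (β 0) := by
  ext θ
  show β ((0 : ℤ) * (θ : ℝ)) = β 0
  simp

/-- `β¹` is the injective loop. [folklore] -/
theorem loopPow_one (hc : Continuous β) (hp : Periodic β 1) : loopPow hc hp 1 = loop hc hp := by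
  ext θ
  show β ((1 : ℤ) * (θ : ℝ)) = β θ
  simp

/-- `β^{-d}` is the reverse of `β^d` (periodicity). [folklore] -/
theorem loopPow_neg (hc : Continuous β) (hp : Periodic β 1) (d : ℤ) :
    loopPow hc hp (-d) = (loopPow hc hp d).symm := by
  ext θ
  show β (((-d : ℤ) : ℝ) * (θ : ℝ)) = β (d * (σ θ : ℝ))
  rw [coe_symm_eq, Int.cast_neg, mul_sub, mul_one, show (d : ℝ) - d * θ = -(d : ℝ) * θ + d * 1 by ring]
  exact (hp.int_mul d _).symm

/-- **`β^{d+1} ≃ β^d · β`** (the lift `d · min(2θ, 1) + max(2θ - 1, 0)` of the concatenation ends at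
`d + 1`). [folklore] -/
theorem loopPow_succ_homotopic (hc : Continuous β) (hp : Periodic β 1) (d : ℤ) :
    (loopPow hc hp (d + 1)).Homotopic ((loopPow hc hp d).trans (loop hc hp)) := by
  refine (homotopic_loopPow_of_lift hc hp _ (pwLift d 1) (pwLift_zero _ _) (fun θ ↦ ?_)
    (d := d + 1) (by rw [pwLift_one]; push_cast; ring)).symm
  rw [Path.trans_apply]
  split_ifs with h
  · rw [pwLift_of_le _ _ h]
    rfl
  · rw [pwLift_of_ge _ _ (not_le.1 h).le, one_mul]
    show β ((d : ℝ) + (2 * θ - 1)) = β (2 * θ - 1)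
    rw [add_comm, ← mul_one (d : ℝ)]
    exact hp.int_mul d _

/-! ## Images of powers -/

/-- The image of the constant loop is the constant loop. [folklore] -/
theorem map_refl_eq {W : Type*} [TopologicalSpace W] (a : Y) (Φ : C(Y, W)) :
    (Path.refl a).map Φ.continuous = Path.refl (Φ a) := by
  ext θ
  rfl

/-- **If `Φ ∘ β` is null-homotopic, so is `Φ ∘ β^d` for every `d ∈ ℤ`.** [folklore] -/
theorem map_loopPow_homotopic_refl (hc : Continuous β) (hp : Periodic β 1) (Φ : C(Y, Z))
    (hnull : ((loop hc hp).map Φ.continuous).Homotopic (Path.refl _)) (d : ℤ) :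
    ((loopPow hc hp d).map Φ.continuous).Homotopic (Path.refl _) := by
  -- nonnegative powers, by induction
  have hnat : ∀ n : ℕ, ((loopPow hc hp n).map Φ.continuous).Homotopic (Path.refl _) := by
    intro n
    induction n with
    | zero =>
      rw [Nat.cast_zero, loopPow_zero, map_refl_eq]
    | succ n ih =>
      have h₁ := (loopPow_succ_homotopic hc hp n).map Φ
      rw [Path.map_trans] at h₁
      have h₂ : (((loopPow hc hp n).map Φ.continuous).trans ((loop hc hp).map Φ.continuous)).Homotopic
          ((Path.refl _).trans (Path.refl _)) := Path.Homotopic.hcomp ih hnull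
      have h₃ : ((Path.refl (Φ (β 0))).trans (Path.refl _)).Homotopic (Path.refl _) :=
        ⟨Path.Homotopy.reflTrans _⟩
      rw [Nat.cast_succ]
      exact (h₁.trans h₂).trans h₃
  obtain ⟨n, rfl | rfl⟩ := Int.eq_nat_or_neg d
  · exact hnat n
  · rw [loopPow_neg, ← Path.map_symm, ← Path.refl_symm]
    exact ⟨Path.Homotopy.symm₂ (Classical.choice (hnat n))⟩

/-- **If the image loop `Φ ∘ β` of the injective loop is null-homotopic, then the image of every
loop of the circle at `β 0` is null-homotopic.** [folklore] -/
theorem map_homotopic_refl_of_map_loop [T2Space Y] (hc : Continuous β) (hp : Periodic β 1)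
    (hinj : InjOn β (Ico 0 1)) (hsurj : range β = univ) (Φ : C(Y, Z))
    (hnull : ((loop hc hp).map Φ.continuous).Homotopic (Path.refl _)) (h : Path (β 0) (β 0)) :
    (h.map Φ.continuous).Homotopic (Path.refl _) := by
  obtain ⟨d, hd⟩ := exists_homotopic_loopPow hc hp hinj hsurj h
  exact (hd.map Φ).trans (map_loopPow_homotopic_refl hc hp Φ hnull d)

/-- The same for a loop based at any point `a = β 0` of the circle (cast). [folklore] -/
theorem map_homotopic_refl_of_map_loop' [T2Space Y] (hc : Continuous β) (hp : Periodic β 1)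
    (hinj : InjOn β (Ico 0 1)) (hsurj : range β = univ) (Φ : C(Y, Z))
    (hnull : ((loop hc hp).map Φ.continuous).Homotopic (Path.refl _)) {a : Y} (ha : a = β 0)
    (h : Path a a) : (h.map Φ.continuous).Homotopic (Path.refl _) := by
  subst ha
  exact map_homotopic_refl_of_map_loop hc hp hinj hsurj Φ hnull h

end CircleLoops

end Literature.Topology.PlanarFoliations
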